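import Literature.NumberTheory.Automorphic.MeyerRatLogCoordinate
import Mathlib.Analysis.MellinInversion
import HarnessLib

/-!
# Meyer's global difference representation — proofs, `K = ℚ`: the Mellin transform of unramified
# vectors of `H₋`

Topic `NumberTheory/Automorphic`; namespace `Literature.NumberTheory.Automorphic.Meyer`. Sibling
PROOF file of `MeyerDifferenceRepresentation` (Step C of the plan for
`Meyer.spectralRealisation_rat` [Meyer2005, Thm. 5.11]). For an `𝒪̂ˣ`-invariant `f ∈ H₋ = 𝒮(C_ℚ)_ℝ`
Meyer's Fourier–Laplace transform at the unramified quasi-characters `|x|^z` is the Mellin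
transform of `ψ(t) = f [z(t)]` (`t > 0`): `f̂(|x|^z) = ∫_{C_ℚ} f |x|^z d^×x = ∫₀^∞ ψ(t) t^{z-1} dt`
[Meyer2005, §2.3 and Lemma 5.10: "The Fourier–Laplace transform maps `𝒮(C_K)_I` isomorphically
onto a space of holomorphic functions on `Re ω ∈ I` …"]. With `ψ = (t ↦ f (posClass (log t)))` and
Mathlib's `mellin` we prove, for `f ∈ H₋` unramified:

* `norm_apply_posClass_log_le` — `‖ψ(t)‖ ≤ C_α t^{-α}` for EVERY real `α` (from the transfer theorem
  `mem_Hminus_iff_of_unramified`); `continuousOn_psi`;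
* **`mellinConvergent_of_mem_Hminus`, `differentiableAt_mellin_of_mem_Hminus`** — the Mellin transform
  converges and is holomorphic at EVERY `z ∈ ℂ` (`f̂` is entire) [Meyer2005, Lemma 5.10];
* **`mellin_classTranslate_eq`** — equivariance `(λ_g f)^(z) = |g|^z f̂(z)` [Meyer2005, §2.3:
  "`f ↦ f̂(ω)` is an equivariant map to `ℂ(ω)`"];
* `mellin_sub_of_mem_Hminus` — linearity;
* **`eq_zero_of_mellin_eq_zero`** — injectivity: if `f̂ = 0` then `f = 0` (via `mellin_eq_fourier`
  and the Fourier inversion formula on the line `Re z = 0`).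

Everything is proved; no definitions, no named facts.

## References

* R. Meyer, *On a representation of the idele class group related to primes and zeros of
  L-functions*, Duke Math. J. 127 (2005) = arXiv:math/0311468, §2.3, Lemma 5.10, §5.7 [Meyer2005].
-/

noncomputable section

open MeasureTheory Set Filter Asymptotics NumberField
open scoped Topology FourierTransform ContDiff

namespace Literature.NumberTheory.Automorphic.Meyer

section Bounds

variable {f : IdeleClassGroup ℚ → ℂ}

/-- The bounds of the transfer theorem: for an unramified `f ∈ H₋`, every real `α` and all
`n, β ∈ ℕ`, `sup_y (1+|y|)^β ‖∂ⁿ(f[z(e^y)] e^{αy})‖ < ∞`. [cite: Meyer2005, §4.1] -/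
theorem exists_bound_of_mem_Hminus
    (hunr : ∀ u ∈ integralFiniteUnits ℚ, ∀ x, f (x * finiteUnitClass ℚ u) = f x) (hf : f ∈ Hminus ℚ)
    (α : ℝ) (n β : ℕ) :
    ∃ C : ℝ, ∀ y : ℝ, (1 + |y|) ^ β *
      ‖iteratedFDeriv ℝ n (fun y : ℝ => f (posClass y) * (Real.exp (α * y) : ℂ)) y‖ ≤ C :=
  (((mem_Hminus_iff_of_unramified hunr).mp hf) α).2 n β

/-- An unramified `f ∈ H₋` is smooth in the logarithmic coordinate. [cite: Meyer2005, §4.1] -/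
theorem contDiff_apply_posClass
    (hunr : ∀ u ∈ integralFiniteUnits ℚ, ∀ x, f (x * finiteUnitClass ℚ u) = f x) (hf : f ∈ Hminus ℚ) :
    ContDiff ℝ ∞ (fun y : ℝ => f (posClass y)) := by
  have h := (((mem_Hminus_iff_of_unramified hunr).mp hf) 0).1
  have hfun : (fun y : ℝ => f (posClass y) * (Real.exp (0 * y) : ℂ)) = fun y : ℝ => f (posClass y) := by
    funext y
    rw [zero_mul, Real.exp_zero, Complex.ofReal_one, mul_one]
  rwa [hfun] at h

/-- **Decay of every order at both ends**: for an unramified `f ∈ H₋` and every real `α` there is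
`C` with `‖f [z(t)]‖ ≤ C t^{-α}` for all `t > 0`. [cite: Meyer2005, §1 (1.2)] -/
theorem norm_apply_posClass_log_le
    (hunr : ∀ u ∈ integralFiniteUnits ℚ, ∀ x, f (x * finiteUnitClass ℚ u) = f x) (hf : f ∈ Hminus ℚ) (α : ℝ) :
    ∃ C : ℝ, ∀ t : ℝ, 0 < t → ‖f (posClass (Real.log t))‖ ≤ C * t ^ (-α) := by
  obtain ⟨C, hC⟩ := exists_bound_of_mem_Hminus hunr hf α 0 0
  refine ⟨C, fun t ht => ?_⟩
  have h := hC (Real.log t)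
  rw [pow_zero, one_mul, norm_iteratedFDeriv_zero, norm_mul, Complex.norm_real, Real.norm_eq_abs,
    Real.abs_exp, ← Real.log_rpow ht, Real.exp_log (Real.rpow_pos_of_pos ht α)] at h
  -- `h : ‖f (posClass (log t))‖ * t ^ α ≤ C`
  have htα : 0 < t ^ α := Real.rpow_pos_of_pos ht α
  rw [Real.rpow_neg ht.le, ← div_eq_mul_inv, le_div_iff₀ htα]
  exact h

/-- `ψ(t) = f [z(t)]` is continuous on `(0, ∞)`. [folklore] -/
theorem continuousOn_apply_posClass_log
    (hunr : ∀ u ∈ integralFiniteUnits ℚ, ∀ x, f (x * finiteUnitClass ℚ u) = f x) (hf : f ∈ Hminus ℚ) :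
    ContinuousOn (fun t : ℝ => f (posClass (Real.log t))) (Ioi 0) :=
  (contDiff_apply_posClass hunr hf).continuous.comp_continuousOn
    (Real.continuousOn_log.mono fun _ ht => ne_of_gt ht)

/-- `ψ = O(t^{-a})` at `+∞` for every `a`. [cite: Meyer2005, §1 (1.2)] -/
theorem isBigO_atTop_apply_posClass_log
    (hunr : ∀ u ∈ integralFiniteUnits ℚ, ∀ x, f (x * finiteUnitClass ℚ u) = f x) (hf : f ∈ Hminus ℚ) (a : ℝ) :
    (fun t : ℝ => f (posClass (Real.log t))) =O[atTop] fun t : ℝ => t ^ (-a) := by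
  obtain ⟨C, hC⟩ := norm_apply_posClass_log_le hunr hf a
  refine IsBigO.of_bound C ?_
  filter_upwards [eventually_gt_atTop (0 : ℝ)] with t ht
  rw [Real.norm_of_nonneg (Real.rpow_nonneg ht.le _)]
  exact hC t ht

/-- `ψ = O(t^{-b})` at `0⁺` for every `b`. [cite: Meyer2005, §1 (1.2)] -/
theorem isBigO_nhdsGT_apply_posClass_log
    (hunr : ∀ u ∈ integralFiniteUnits ℚ, ∀ x, f (x * finiteUnitClass ℚ u) = f x) (hf : f ∈ Hminus ℚ) (b : ℝ) :
    (fun t : ℝ => f (posClass (Real.log t))) =O[𝓝[>] (0 : ℝ)] fun t : ℝ => t ^ (-b) := by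
  obtain ⟨C, hC⟩ := norm_apply_posClass_log_le hunr hf b
  refine IsBigO.of_bound C ?_
  filter_upwards [self_mem_nhdsWithin] with t ht
  rw [Real.norm_of_nonneg (Real.rpow_nonneg (le_of_lt ht) _)]
  exact hC t ht

end Bounds

/-! ### The Mellin transform is entire, equivariant, linear and injective -/

section Mellin

variable {f g : IdeleClassGroup ℚ → ℂ}

/-- **The Mellin transform of an unramified `f ∈ H₋` converges at every `z ∈ ℂ`.**
[cite: Meyer2005, Lemma 5.10] -/
theorem mellinConvergent_of_mem_Hminus
    (hunr : ∀ u ∈ integralFiniteUnits ℚ, ∀ x, f (x * finiteUnitClass ℚ u) = f x) (hf : f ∈ Hminus ℚ) (z : ℂ) :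
    MellinConvergent (fun t : ℝ => f (posClass (Real.log t))) z :=
  mellinConvergent_of_isBigO_rpow
    ((continuousOn_apply_posClass_log hunr hf).locallyIntegrableOn measurableSet_Ioi)
    (isBigO_atTop_apply_posClass_log hunr hf (z.re + 1)) (by linarith)
    (isBigO_nhdsGT_apply_posClass_log hunr hf (z.re - 1)) (by linarith)

/-- **`f̂(z) = ∫₀^∞ f[z(t)] t^{z-1} dt` is entire** for an unramified `f ∈ H₋` [Meyer2005, Lemma 5.10:
the Fourier–Laplace transform of `𝒮(C_K)_ℝ` consists of holomorphic functions on all of `Ĉ_K`].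
[cite: Meyer2005, Lemma 5.10] -/
theorem differentiableAt_mellin_of_mem_Hminus
    (hunr : ∀ u ∈ integralFiniteUnits ℚ, ∀ x, f (x * finiteUnitClass ℚ u) = f x) (hf : f ∈ Hminus ℚ) (z : ℂ) :
    DifferentiableAt ℂ (mellin (fun t : ℝ => f (posClass (Real.log t)))) z :=
  mellin_differentiableAt_of_isBigO_rpow
    ((continuousOn_apply_posClass_log hunr hf).locallyIntegrableOn measurableSet_Ioi)
    (isBigO_atTop_apply_posClass_log hunr hf (z.re + 1)) (by linarith)
    (isBigO_nhdsGT_apply_posClass_log hunr hf (z.re - 1)) (by linarith)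

/-- The Mellin transform of an unramified `f ∈ H₋` is an entire function. [cite: Meyer2005, Lemma 5.10] -/
theorem differentiable_mellin_of_mem_Hminus
    (hunr : ∀ u ∈ integralFiniteUnits ℚ, ∀ x, f (x * finiteUnitClass ℚ u) = f x) (hf : f ∈ Hminus ℚ) :
    Differentiable ℂ (mellin (fun t : ℝ => f (posClass (Real.log t)))) :=
  fun z => differentiableAt_mellin_of_mem_Hminus hunr hf z

/-- A translate of an unramified function, read in the coordinate `t`: `(λ_g f)[z(t)] = f[z(t/|g|)]`.
[cite: Meyer2005, §3.1 (3.1)] -/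
theorem classTranslate_apply_posClass_log
    (hunr : ∀ u ∈ integralFiniteUnits ℚ, ∀ x, f (x * finiteUnitClass ℚ u) = f x)
    (g : IdeleClassGroup ℚ) {t : ℝ} (ht : 0 < t) :
    classTranslate ℚ g f (posClass (Real.log t)) = f (posClass (Real.log ((classNorm ℚ g)⁻¹ * t))) := by
  rw [classTranslate_apply, posClass_mul_isUnramified hunr, classNorm, map_inv, NNReal.coe_inv,
    Real.log_inv, Real.log_mul (inv_ne_zero (classNorm_ne_zero g)) ht.ne', Real.log_inv]

/-- **Equivariance of the Mellin transform**: `(λ_g f)^(z) = |g|^z · f̂(z)` for every unramified `f`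
and every idele class `g` [Meyer2005, §2.3: evaluation of the Fourier–Laplace transform at `ω` is
an equivariant map to `ℂ(ω)`]. [cite: Meyer2005, §2.3] -/
theorem mellin_classTranslate_eq
    (hunr : ∀ u ∈ integralFiniteUnits ℚ, ∀ x, f (x * finiteUnitClass ℚ u) = f x)
    (g : IdeleClassGroup ℚ) (z : ℂ) :
    mellin (fun t : ℝ => classTranslate ℚ g f (posClass (Real.log t))) z =
      ((classNorm ℚ g : ℝ) : ℂ) ^ z * mellin (fun t : ℝ => f (posClass (Real.log t))) z := by
  have hc : 0 < (classNorm ℚ g)⁻¹ := inv_pos.mpr (classNorm_pos g)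
  have h1 : mellin (fun t : ℝ => classTranslate ℚ g f (posClass (Real.log t))) z =
      mellin (fun t : ℝ => f (posClass (Real.log ((classNorm ℚ g)⁻¹ * t)))) z := by
    rw [mellin, mellin]
    refine setIntegral_congr_fun measurableSet_Ioi fun t ht => ?_
    rw [classTranslate_apply_posClass_log hunr g ht]
  rw [h1, mellin_comp_mul_left (fun t : ℝ => f (posClass (Real.log t))) z hc, smul_eq_mul]
  congr 1
  rw [Complex.ofReal_inv, Complex.inv_cpow _ _ (by
      rw [Complex.arg_ofReal_of_nonneg (classNorm_pos g).le]; exact Real.pi_ne_zero.symm),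
    Complex.cpow_neg, inv_inv]

/-- **Linearity**: the Mellin transform of a difference of unramified vectors of `H₋` is the
difference of the Mellin transforms. [folklore] -/
theorem mellin_sub_of_mem_Hminus
    (hfu : ∀ u ∈ integralFiniteUnits ℚ, ∀ x, f (x * finiteUnitClass ℚ u) = f x) (hf : f ∈ Hminus ℚ)
    (hgu : ∀ u ∈ integralFiniteUnits ℚ, ∀ x, g (x * finiteUnitClass ℚ u) = g x) (hg : g ∈ Hminus ℚ) (z : ℂ) :
    mellin (fun t : ℝ => (f - g) (posClass (Real.log t))) z =
      mellin (fun t : ℝ => f (posClass (Real.log t))) z - mellin (fun t : ℝ => g (posClass (Real.log t))) z := by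
  rw [mellin, mellin, mellin, ← integral_sub (mellinConvergent_of_mem_Hminus hfu hf z)
    (mellinConvergent_of_mem_Hminus hgu hg z)]
  refine setIntegral_congr_fun measurableSet_Ioi fun t _ => ?_
  simp only [Pi.sub_apply, smul_eq_mul, mul_sub]

/-- An unramified `f ∈ H₋` is integrable in the logarithmic coordinate. [folklore] -/
theorem integrable_apply_posClass
    (hunr : ∀ u ∈ integralFiniteUnits ℚ, ∀ x, f (x * finiteUnitClass ℚ u) = f x) (hf : f ∈ Hminus ℚ) :
    Integrable (fun y : ℝ => f (posClass y)) := by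
  obtain ⟨C, hC⟩ := exists_bound_of_mem_Hminus hunr hf 0 0 2
  have hcont : Continuous fun y : ℝ => f (posClass y) := (contDiff_apply_posClass hunr hf).continuous
  have hbound : ∀ y : ℝ, ‖f (posClass y)‖ ≤ C * (1 + ‖y‖) ^ (-(2 : ℝ)) := by
    intro y
    have h := hC y
    rw [norm_iteratedFDeriv_zero, norm_mul, Complex.norm_real, Real.norm_eq_abs, zero_mul, Real.exp_zero,
      abs_one, mul_one] at h
    have hpos : 0 < (1 + |y|) ^ 2 := by positivity
    rw [Real.norm_eq_abs, Real.rpow_neg (by positivity), ← div_eq_mul_inv, le_div_iff₀ (by positivity),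
      Real.rpow_two, mul_comm]
    exact h
  refine Integrable.mono' ((integrable_one_add_norm (r := 2) (by rw [Module.finrank_self]; norm_num)).const_mul C)
    hcont.aestronglyMeasurable ?_
  exact Eventually.of_forall hbound

/-- **Injectivity of the Mellin transform on unramified vectors of `H₋`**: if `f̂(z) = 0` for all
`z` on the line `Re z = 0` then `f = 0` (Mellin = Fourier in the logarithmic coordinate, and the
Fourier inversion formula). [cite: Meyer2005, Lemma 5.10] -/
theorem eq_zero_of_mellin_eq_zero
    (hunr : ∀ u ∈ integralFiniteUnits ℚ, ∀ x, f (x * finiteUnitClass ℚ u) = f x) (hf : f ∈ Hminus ℚ)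
    (h0 : ∀ τ : ℝ, mellin (fun t : ℝ => f (posClass (Real.log t))) (τ * Complex.I) = 0) : f = 0 := by
  -- the function in the Fourier picture: `G(u) = f[z(e^{-u})]`
  set G : ℝ → ℂ := fun u => f (posClass (-u)) with hG
  have hGf : ∀ s : ℂ, s.re = 0 →
      (fun u : ℝ => Real.exp (-s.re * u) • f (posClass (Real.log (Real.exp (-u))))) = G := by
    intro s hs
    funext u
    rw [hs, neg_zero, zero_mul, Real.exp_zero, one_smul, Real.log_exp]
  have hFG : ∀ ξ : ℝ, 𝓕 G ξ = 0 := by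
    intro ξ
    have h := mellin_eq_fourier (fun t : ℝ => f (posClass (Real.log t))) (s := ((2 * Real.pi * ξ : ℝ) : ℂ) * Complex.I)
    have hre : (((2 * Real.pi * ξ : ℝ) : ℂ) * Complex.I).re = 0 := by simp
    have him : (((2 * Real.pi * ξ : ℝ) : ℂ) * Complex.I).im / (2 * Real.pi) = ξ := by
      rw [show (((2 * Real.pi * ξ : ℝ) : ℂ) * Complex.I).im = 2 * Real.pi * ξ by simp]
      field_simp
    rw [hGf _ hre, him, h0] at h
    exact h.symm
  -- `G` is continuous and integrable, so Fourier inversion gives `G = 0`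
  have hGcont : Continuous G :=
    (contDiff_apply_posClass hunr hf).continuous.comp continuous_neg
  have hGint : Integrable G := (integrable_apply_posClass hunr hf).comp_neg
  have hFGint : Integrable (𝓕 G) := by
    have : 𝓕 G = 0 := funext hFG
    rw [this]
    exact integrable_zero _ _ _
  have hGzero : G = 0 := by
    have hinv := hGcont.fourierInv_fourier_eq hGint hFGint
    have : 𝓕 G = 0 := funext hFG
    rw [this] at hinv
    rw [← hinv]
    funext w
    simp [Real.fourierInv_eq]
  -- hence `f = 0`
  funext c
  rw [apply_eq_apply_posClass_log hunr c]
  have h := congrFun hGzero (-Real.log (classNorm ℚ c))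
  rw [hG] at h
  simp only [neg_neg, Pi.zero_apply] at h
  exact h

end Mellin

end Literature.NumberTheory.Automorphic.Meyer
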